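import Mathlib

/-!
# CRIT-1 g32 — round-2 card `coercive-transfer-ct` (seat -4): critic's kernel (two checkable remarks)

(K1) `coercivityStable_rel` — the N-RELATIVE stability the covariant comparison needs: the form defect of the covariant
fine-lattice Laplacian against the flat one is bounded by `|A|_∞ · ⟨f, N f⟩` with `N = −Δ_η + I` (first-order term `A·f·∇_η f`,
second-order `O(A²)‖f‖²`), NOT by `|A|_∞ · ‖f‖²` uniformly in the spacing `η` (the operator-norm defect per bond is
`η⁻²|U − 1| ≈ |A|∕η`). Seat -4's `CoercivityStable` (absolute version) is true but does not cover that comparison; this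
relative version does, with the same two lines of algebra.
(K2) `zeroDiag` — `CombesThomasAbs` is stated for a pseudo-metric WITHOUT `d i i = 0`; it is still TRUE as typed because the
weighted-Schur hypothesis only weakens and the off-diagonal conclusion is unchanged when `d` is replaced by its zero-diagonal
modification, which is again a pseudo-metric (checked below); so the natural proof (weight `ρ = d(·, j)`, needing `ρ j = 0`)
goes through after this reduction. No kill from the `d i i ≠ 0` corner.

HONEST: finite-dimensional algebra only; nothing of Bałaban asserted; K0⁷ open; COUNT 8∕28 · K 1∕4 unmoved; the Yang–Mills
mass gap (Clay) is NOT proved by any of this.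
-/

namespace Summit.QuantumFields.YangMills.Cruxes.Record13SepCoPHInhabited.Crit1R2CoerciveTransfer

open Matrix

/-- (K1) Relative coercivity stability: `K ≥ c₀ N`, `|P| ≤ c₂ N` as forms with `c₂ ≤ c₀∕2`, `N ≥ 0` ⟹ `K + P ≥ (c₀∕2) N`. [folklore] -/
theorem coercivityStable_rel {ι : Type*} [Fintype ι] (K P N : Matrix ι ι ℝ) (c₀ c₂ : ℝ) (hc₂ : c₂ ≤ c₀ / 2)
    (hK : ∀ f : ι → ℝ, c₀ * (f ⬝ᵥ (N *ᵥ f)) ≤ f ⬝ᵥ (K *ᵥ f)) (hP : ∀ f : ι → ℝ, |f ⬝ᵥ (P *ᵥ f)| ≤ c₂ * (f ⬝ᵥ (N *ᵥ f)))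
    (hN : ∀ f : ι → ℝ, 0 ≤ f ⬝ᵥ (N *ᵥ f)) (f : ι → ℝ) :
    c₀ / 2 * (f ⬝ᵥ (N *ᵥ f)) ≤ f ⬝ᵥ ((K + P) *ᵥ f) := by
  have h1 := hK f
  have h2 := hP f
  have h4 := hN f
  have h3 : -(c₂ * (f ⬝ᵥ (N *ᵥ f))) ≤ f ⬝ᵥ (P *ᵥ f) := by
    have := neg_abs_le (f ⬝ᵥ (P *ᵥ f)); linarith
  rw [Matrix.add_mulVec, dotProduct_add]
  nlinarith

/-- (K2) Zero-diagonal modification of a pseudo-metric. [folklore] -/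
def zeroDiag {ι : Type*} [DecidableEq ι] (d : ι → ι → ℝ) : ι → ι → ℝ := fun i j => if i = j then 0 else d i j

theorem zeroDiag_nonneg {ι : Type*} [DecidableEq ι] {d : ι → ι → ℝ} (h : ∀ i j, 0 ≤ d i j) (i j : ι) :
    0 ≤ zeroDiag d i j := by
  unfold zeroDiag; split_ifs <;> simp [h]

theorem zeroDiag_symm {ι : Type*} [DecidableEq ι] {d : ι → ι → ℝ} (h : ∀ i j, d i j = d j i) (i j : ι) :
    zeroDiag d i j = zeroDiag d j i := by
  unfold zeroDiag
  by_cases hij : i = j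
  · subst hij; simp
  · have hji : ¬ j = i := fun h' => hij h'.symm
    simp [hij, hji, h i j]

theorem zeroDiag_triangle {ι : Type*} [DecidableEq ι] {d : ι → ι → ℝ} (h0 : ∀ i j, 0 ≤ d i j)
    (ht : ∀ i j l, d i l ≤ d i j + d j l) (i j l : ι) :
    zeroDiag d i l ≤ zeroDiag d i j + zeroDiag d j l := by
  unfold zeroDiag
  by_cases hil : i = l
  · subst hil
    simp only [if_true]
    have := h0 i j; have := h0 j i
    split_ifs <;> linarith
  · simp only [hil, if_false]
    by_cases hij : i = j
    · subst hij; simp [hil]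
    · by_cases hjl : j = l
      · subst hjl; simp [hij]
      · simp only [hij, hjl, if_false]; exact ht i j l

/-- The zero-diagonal modification is pointwise below `d` (for `d ≥ 0`), so every weighted-Schur row∕column sum with weights
`e^{μ·zeroDiag d} − 1`, `μ ≥ 0`, is bounded by the one with `d`: the hypothesis of `CombesThomasAbs` WEAKENS under the reduction. [folklore] -/
theorem zeroDiag_weight_le {ι : Type*} [DecidableEq ι] {d : ι → ι → ℝ} (h0 : ∀ i j, 0 ≤ d i j) {μ : ℝ} (hμ : 0 ≤ μ)
    (i j : ι) : Real.exp (μ * zeroDiag d i j) - 1 ≤ Real.exp (μ * d i j) - 1 := by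
  have hle : zeroDiag d i j ≤ d i j := by
    unfold zeroDiag; split_ifs <;> simp [h0]
  have := Real.exp_le_exp.2 (mul_le_mul_of_nonneg_left hle hμ)
  linarith

/-- Off the diagonal the modification changes nothing, so the CONCLUSION of `CombesThomasAbs` for `i ≠ j` is the same statement. [folklore] -/
theorem zeroDiag_off_diag {ι : Type*} [DecidableEq ι] (d : ι → ι → ℝ) {i j : ι} (hij : i ≠ j) :
    zeroDiag d i j = d i j := by
  unfold zeroDiag; simp [hij]

end Summit.QuantumFields.YangMills.Cruxes.Record13SepCoPHInhabited.Crit1R2CoerciveTransfer
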